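import Summits.HodgeConjecture.CorCM.Census.HalfParityCocycle
import Summits.HodgeConjecture.CorCM.Census.HalfParityBounds
import Summits.HodgeConjecture.CorCM.Census.CoinvariantComplementLaw

/-!
# The half-parity law, X: ANDRÉ-3ʼS LAW IS A THEOREM — `φ₂(G, c) + 1 + δ(G, c) = β(G, c) + t(G, c)` for every `(G, c)`

COR-CM (cell `pub-hodgecm2`), count-neutral kernel combinatorics by the binder seat b09 (gen 31; lane DIRECT-FACTOR, sequel
«CLOSED-FORM LAW» = lit-andre-3ʼs ask A6-R55), part X of the HALF-PARITY series, sequel of `Census/HalfParityCocycle.lean` (IX).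
One bookkeeping definition with body (`addKer`, the kernel of an additive `𝔽₂`-valued map on `G` as a subgroup) + theorems; no
`decide` beyond closed identities in `𝔽₂`, no certificate, no named fact, no `sorry`.  HONEST FRAMING: `HC_CM` is NOT proved; nothing
here is a period or a headline.

THE THEOREM (`card_block_add_halfRank_eq_fibreTwo_add`).  For every finite group `G` and every central involution `c ≠ 1`:
**`β(G, c) + t(G, c) = φ₂(G, c) + 1 + δ(G, c)`**, where `φ₂ = dim_𝔽₂ (Λ⊗𝔽₂)_G` is the coinvariant fibre (gen 29), `β` the number of
blocks, `δ ∈ {0,1}` the weight-parity invariant (gen 28) and `t = halfRank` the rank of the admissible half-parities beyond the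
parities (gen 30, III).  Gen 30 proved `≤` (THE FLOOR); this file proves `≥`, i.e. (`inf_ker_par2_prod_hpi_le_rad2`)
**`hodge2 ∩ ker par2 ∩ ker hpi ≤ rad2`: a Hodge vector mod `2` killed by every block parity and every admissible half-parity is a sum
of pairs and coboundaries** — equivalently (`fibreTwo_eq_finrank_map_prod`) the `G`-invariant functionals of the coinvariant fibre
are EXACTLY the block parities plus the admissible half-parities (André-3ʼs law, PORTFOLIO-lit-andre-3-g17 §0 (B), 58/58 types of
order `≤ 24`; closed form `t = d₂(G/𝒦) − [|G|/2 even] + δ`… see lit-andre-3 g18 and b09 g31 numerics, `≈ 100` rows through order 32).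

PROOF.  If `x ∈ hodge2 ∩ ker par2 ∩ ker hpi` were not in `rad2`, a functional `λ` would separate it from `rad2`
(`Submodule.exists_dual_map_eq_bot_of_notMem`); `λ` kills the pairs and is `G`-invariant on `hodge2`.  Part IX normalises it:
`λ′ = λ + d_μ` with a potential `μ` of even weight (`exists_potential`: (E1), and (E2) for `|G|/2` even, `μ ↦ μ + 1` for `|G|/2`
odd) agrees with `λ` on `hodge2` and satisfies `λ′(v·Q⁻¹) = λ′(v) + e(Q)·mass(v)` with `e : G → 𝔽₂` additive, `e(c) = 0`.  If
`e = 0`, `λ′` is an invariant AMBIENT functional, hence a parity combination (I `exists_eq_sum_par2_of_invariant`), so `λ′(x) = 0`.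
Otherwise `H = ker e` has index two and contains `c`, `λ′` is `H`-invariant and `G`-invariant on the faces (mass kills `hodge2`), so
by THE LIFT THEOREM (VIII `apply_eq_zero_of_hpi_eq_zero`) `λ′(x) = 0`.  Either way `λ(x) = λ′(x) = 0`, a contradiction.  The count
`φ₂ ≤ dim par2(hodge2) + dim hpi(hodge2 ∩ ker par2) = (β − 1 − δ) + t` is rank–nullity (III `finrank_map_prod_eq`).

## References
* [Pohlmann1968] H. Pohlmann, Algebraic cycles on abelian varieties of complex multiplication type, Ann. of Math. 88 (1968), Thm 1.
* [Milne1999] J. S. Milne, Lefschetz motives and the Tate conjecture, Compositio Math. 117 (1999), Prop. 2.1, p. 54.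
-/

namespace Summit.HodgeConjecture.CorCM.Census.HalfParity

open Finset
open Summit.HodgeConjecture.CorCM.Prior.AllgGroup.RfwfAllgGroup
open Summit.HodgeConjecture.CorCM.Census.BlockParity
open Summit.HodgeConjecture.CorCM.Census.Coinvariant

noncomputable section

variable {G : Type*} [Group G] [Fintype G] [DecidableEq G] (c : G)

/-! ## §1 A potential of even weight -/

/-- **A potential of EVEN weight always exists** ((E1) + (E2); for `|G|/2` odd replace `μ` by `μ + 1`). [folklore] -/
theorem exists_potential (hc2 : c * c = 1) (hc1 : c ≠ 1) (hcen : ∀ x : G, x * c = c * x)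
    {lam : (CMF G c →₀ ZMod 2) →ₗ[ZMod 2] ZMod 2} (hpair : pair2 c ≤ LinearMap.ker lam)
    (hinv : ∀ (Q : G), ∀ v ∈ hodge2 c hc2, lam (Finsupp.mapDomain (rt c Q) v) = lam v) (T₀ : CMF G c) :
    ∃ μ : G → ZMod 2, (∀ Q t, cgrad c hc2 lam T₀ Q t = μ t + μ (t * Q⁻¹)) ∧ (∀ t, μ (c * t) = μ t) ∧
      ∑ t ∈ T₀.1, μ t = 0 := by
  have hμ₀ : ∀ Q t, cgrad c hc2 lam T₀ Q t = cgrad c hc2 lam T₀ t⁻¹ 1 + cgrad c hc2 lam T₀ (t * Q⁻¹)⁻¹ 1 :=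
    fun Q t => cgrad_eq_pot_add_pot c hc2 hc1 hcen hinv T₀ Q t
  have hμ₀c : ∀ t, cgrad c hc2 lam T₀ (c * t)⁻¹ 1 = cgrad c hc2 lam T₀ t⁻¹ 1 :=
    fun t => pot_cmul c hc2 hc1 hcen hpair hinv T₀ t
  rcases Nat.even_or_odd (Fintype.card G / 2) with heven | hodd
  · exact ⟨fun t => cgrad c hc2 lam T₀ t⁻¹ 1, hμ₀, hμ₀c,
      sum_pot_eq_zero_of_even c hc2 hc1 hcen hpair hinv T₀ hμ₀ hμ₀c heven⟩
  · by_cases hw : ∑ t ∈ T₀.1, cgrad c hc2 lam T₀ t⁻¹ 1 = 0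
    · exact ⟨fun t => cgrad c hc2 lam T₀ t⁻¹ 1, hμ₀, hμ₀c, hw⟩
    · have key : ∀ a b : ZMod 2, a + b = a + 1 + (b + 1) := by decide
      have two1 : ∀ x : ZMod 2, x ≠ 0 → x = 1 := by decide
      refine ⟨fun t => cgrad c hc2 lam T₀ t⁻¹ 1 + 1, fun Q t => by beta_reduce; rw [hμ₀, key],
        fun t => by beta_reduce; rw [hμ₀c], ?_⟩
      have hcard : Odd T₀.1.card := by
        have h := two_mul_card_val c hc2 T₀
        have e : Fintype.card G / 2 = T₀.1.card := by omega
        rwa [e] at hodd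
      rw [Finset.sum_add_distrib, Finset.sum_const, nsmul_eq_mul, mul_one, two1 _ hw,
        (ZMod.natCast_eq_one_iff_odd).mpr hcard]
      decide

/-! ## §2 The kernel of an additive map as a subgroup -/

/-- The kernel of an additive map `e : G → 𝔽₂` (`e(ab) = e(a) + e(b)`), as a subgroup. [folklore] -/
def addKer (e : G → ZMod 2) (hadd : ∀ a b : G, e (a * b) = e a + e b) : Subgroup G where
  carrier := {g | e g = 0}
  mul_mem' := fun {a b} ha hb => by
    simp only [Set.mem_setOf_eq] at ha hb ⊢
    rw [hadd, ha, hb, add_zero]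
  one_mem' := by
    have h := hadd 1 1
    rw [mul_one] at h
    have key : ∀ x : ZMod 2, x = x + x → x = 0 := by decide
    exact key _ h
  inv_mem' := fun {a} ha => by
    simp only [Set.mem_setOf_eq] at ha ⊢
    have h1 : e 1 = 0 := by
      have h := hadd 1 1
      rw [mul_one] at h
      have key : ∀ x : ZMod 2, x = x + x → x = 0 := by decide
      exact key _ h
    have h := hadd a a⁻¹
    rw [mul_inv_cancel, h1, ha, zero_add] at h
    exact h.symm

omit [Fintype G] [DecidableEq G] in
/-- Membership in `addKer`. [folklore] -/
@[simp] theorem mem_addKer (e : G → ZMod 2) (hadd : ∀ a b : G, e (a * b) = e a + e b) (g : G) :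
    g ∈ addKer e hadd ↔ e g = 0 := Iff.rfl

omit [Fintype G] [DecidableEq G] in
/-- A non-zero additive map to `𝔽₂` has a kernel of index two. [folklore] -/
theorem index_addKer (e : G → ZMod 2) (hadd : ∀ a b : G, e (a * b) = e a + e b) {g : G} (hg : e g = 1) :
    (addKer e hadd).index = 2 := by
  refine Subgroup.index_eq_two_iff.mpr ⟨g, fun b => ?_⟩
  rw [mem_addKer, mem_addKer, hadd, hg]
  have key : ∀ y : ZMod 2, y + 1 = 0 ↔ ¬ y = 0 := by decide
  have h := key (e b)
  tauto

/-! ## §3 THE MAIN LEMMA: `hodge2 ∩ ker par2 ∩ ker hpi ≤ rad2` -/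

/-- **MAIN.**  A Hodge vector mod `2` killed by every block parity and every admissible half-parity lies in `rad2 = pairs +
coboundaries`. [folklore] -/
theorem mem_rad2_of_par2_eq_zero_of_hpi_eq_zero (hc2 : c * c = 1) (hc1 : c ≠ 1) (hcen : ∀ x : G, x * c = c * x)
    {x : CMF G c →₀ ZMod 2} (hx : x ∈ hodge2 c hc2) (hpx : par2 c x = 0) (hhx : hpi c hc2 x = 0) : x ∈ rad2 c hc2 := by
  by_contra hxr
  obtain ⟨lam, hlx, hker⟩ := Submodule.exists_dual_map_eq_bot_of_notMem hxr inferInstance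
  have hrad : rad2 c hc2 ≤ LinearMap.ker lam := LinearMap.le_ker_iff_map.mpr hker
  have hpair : pair2 c ≤ LinearMap.ker lam := (pair2_le_rad2 c hc2).trans hrad
  have hinv : ∀ (Q : G), ∀ v ∈ hodge2 c hc2, lam (Finsupp.mapDomain (rt c Q) v) = lam v := fun Q v hv =>
    sub_eq_zero.mp (by rw [← map_sub]; exact LinearMap.mem_ker.mp (hrad (mapDomain_rt_sub_mem_rad2 c hc2 hcen Q hv)))
  obtain ⟨T, hT⟩ := exists_isCMF c hc2 hc1
  set T₀ : CMF G c := ⟨T, hT⟩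
  obtain ⟨μ, hμ, hμc, hw⟩ := exists_potential c hc2 hc1 hcen hpair hinv T₀
  obtain ⟨e, he, hadd, hec⟩ := exists_hom_of_potential c hc2 hc1 hcen hpair hinv T₀ hμ hμc
  rw [hw] at hec
  -- `λ' = λ + d_μ` agrees with `λ` on `x`
  obtain ⟨a, ha⟩ := exists_forall_ts2_eq_of_mem_hodge2 c hc2 hcen hx
  have hx' : (lam + corr c T₀ μ) x ≠ 0 := by
    rw [LinearMap.add_apply, corr_eq_of_forall_ts2_eq c T₀ μ ha, hw, mul_zero, add_zero]
    exact hlx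
  by_cases hall : ∀ g, e g = 0
  · -- `λ'` is an invariant ambient functional: a parity combination
    obtain ⟨b, hb⟩ := exists_eq_sum_par2_of_invariant c (lam + corr c T₀ μ) fun Q v => by
      rw [he, hall, zero_mul, add_zero]
    exact hx' (by rw [hb, hpx]; simp)
  · -- `λ'` is `H = ker e`-invariant and `G`-invariant on the faces: THE LIFT THEOREM applies
    push Not at hall
    obtain ⟨g, hg⟩ := hall
    have two1 : ∀ x : ZMod 2, x ≠ 0 → x = 1 := by decide
    have hH := index_addKer e hadd (two1 _ hg)
    have hcH : c ∈ addKer e hadd := (mem_addKer e hadd c).mpr hec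
    refine hx' (apply_eq_zero_of_hpi_eq_zero c hc2 hH hcH (fun Q hQ v => ?_) (fun Q v hv => ?_) hpx hhx)
    · rw [he, (mem_addKer e hadd Q).mp hQ, zero_mul, add_zero]
    · rw [he, mass_eq_zero_of_mem_hodge2 c hc2 hcen (Submodule.mem_sup_left hv : v ∈ hodge2 c hc2), mul_zero, add_zero]

/-- **`hodge2 ⊓ ker (par2, hpi) ≤ rad2`.** [folklore] -/
theorem inf_ker_par2_prod_hpi_le_rad2 (hc2 : c * c = 1) (hc1 : c ≠ 1) (hcen : ∀ x : G, x * c = c * x) :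
    hodge2 c hc2 ⊓ LinearMap.ker ((par2 c).prod (hpi c hc2)) ≤ rad2 c hc2 := by
  rintro x ⟨hx, hk⟩
  rw [SetLike.mem_coe, LinearMap.mem_ker, LinearMap.prod_apply, Prod.mk_eq_zero] at hk
  exact mem_rad2_of_par2_eq_zero_of_hpi_eq_zero c hc2 hc1 hcen hx hk.1 hk.2

/-! ## §4 THE LAW -/

/-- **`φ₂ + 1 + δ ≤ β + t`** (the EQUALITY half; rank–nullity on `hodge2` for `(par2, hpi)`). [folklore] -/
theorem fibreTwo_add_le_card_block_add_halfRank (hc2 : c * c = 1) (hc1 : c ≠ 1) (hcen : ∀ x : G, x * c = c * x)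
    (T₀ : CMF G c) : fibreTwo c hc2 + 1 + wdelta c T₀ ≤ Fintype.card (Block c) + halfRank c hc2 := by
  have h1 := finrank_rad2_add_fibreTwo c hc2
  have h2 := finrank_map_add_finrank_inf_ker ((par2 c).prod (hpi c hc2)) (hodge2 c hc2)
  have h3 := Submodule.finrank_mono (inf_ker_par2_prod_hpi_le_rad2 c hc2 hc1 hcen)
  have h4 := finrank_map_prod_eq (par2 c) (hpi c hc2) (hodge2 c hc2)
  have h5 := finrank_map_par2_hodge2_add c hc2 T₀
  unfold halfRank
  omega

/-- **ANDRÉ-3ʼS LAW: `β(G, c) + t(G, c) = φ₂(G, c) + 1 + δ(G, c)`** for every finite group `G` and central involution `c ≠ 1` — the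
`G`-invariant functionals of the coinvariant fibre `(Λ⊗𝔽₂)_G` are exactly the block parities and the admissible half-parities.
[folklore] -/
theorem card_block_add_halfRank_eq_fibreTwo_add (hc2 : c * c = 1) (hc1 : c ≠ 1) (hcen : ∀ x : G, x * c = c * x)
    (T₀ : CMF G c) : Fintype.card (Block c) + halfRank c hc2 = fibreTwo c hc2 + 1 + wdelta c T₀ :=
  le_antisymm (card_block_add_halfRank_le_fibreTwo_add c hc2 T₀) (fibreTwo_add_le_card_block_add_halfRank c hc2 hc1 hcen T₀)

/-- `δ`-free form: `β + t = φ₂ + 2` when the weight parity is block-constant, `β + t = φ₂ + 1` otherwise. [folklore] -/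
theorem card_block_add_halfRank_eq_fibreTwo_add_two_or (hc2 : c * c = 1) (hc1 : c ≠ 1) (hcen : ∀ x : G, x * c = c * x) :
    Fintype.card (Block c) + halfRank c hc2 = fibreTwo c hc2 + 2 ∨
      Fintype.card (Block c) + halfRank c hc2 = fibreTwo c hc2 + 1 := by
  obtain ⟨T, hT⟩ := exists_isCMF c hc2 hc1
  have h := card_block_add_halfRank_eq_fibreTwo_add c hc2 hc1 hcen ⟨T, hT⟩
  have h1 := wdelta_le_one c ⟨T, hT⟩
  omega

/-- **`φ₂ = dim_𝔽₂ (par2, hpi)(hodge2)`**: the coinvariant fibre is detected EXACTLY by block parities and admissible half-parities.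
[folklore] -/
theorem fibreTwo_eq_finrank_map_prod (hc2 : c * c = 1) (hc1 : c ≠ 1) (hcen : ∀ x : G, x * c = c * x) :
    fibreTwo c hc2 = Module.finrank (ZMod 2) ↥((hodge2 c hc2).map ((par2 c).prod (hpi c hc2))) := by
  refine le_antisymm ?_ (finrank_map_hodge2_le_fibreTwo c hc2 _ ?_)
  · have h1 := finrank_rad2_add_fibreTwo c hc2
    have h2 := finrank_map_add_finrank_inf_ker ((par2 c).prod (hpi c hc2)) (hodge2 c hc2)
    have h3 := Submodule.finrank_mono (inf_ker_par2_prod_hpi_le_rad2 c hc2 hc1 hcen)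
    omega
  · rw [LinearMap.ker_prod]
    exact le_inf (rad2_le_ker_par2 c hc2) (rad2_le_ker_hpi c hc2)

/-- **`t = 0 ⟺ the parity floor is the truth`**: `halfRank = 0 ↔ φ₂ + 1 + δ = β`. [folklore] -/
theorem halfRank_eq_zero_iff (hc2 : c * c = 1) (hc1 : c ≠ 1) (hcen : ∀ x : G, x * c = c * x) (T₀ : CMF G c) :
    halfRank c hc2 = 0 ↔ fibreTwo c hc2 + 1 + wdelta c T₀ = Fintype.card (Block c) := by
  have h := card_block_add_halfRank_eq_fibreTwo_add c hc2 hc1 hcen T₀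
  omega

/-- **UPPER BOUND BY INDEX-TWO SUBGROUPS: `φ₂ + 1 + δ ≤ β + (1 + δ)·h`**, `h = hTwo` the number of index-two subgroups
containing `c` (VII `halfRank_le_hTwo`); in particular **no index-two subgroup contains `c` ⇒ `φ₂ + 1 + δ = β`**. [folklore] -/
theorem fibreTwo_add_le_card_block_add_mul_hTwo (hc2 : c * c = 1) (hc1 : c ≠ 1) (hcen : ∀ x : G, x * c = c * x)
    (T₀ : CMF G c) : fibreTwo c hc2 + 1 + wdelta c T₀ ≤ Fintype.card (Block c) + (1 + wdelta c T₀) * hTwo c := by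
  have h1 := fibreTwo_add_le_card_block_add_halfRank c hc2 hc1 hcen T₀
  have h2 := halfRank_le_hTwo c hc2 T₀
  omega

/-- **`h = 0` (no index-two subgroup contains `c`) ⇒ `φ₂ + 1 + δ = β`.** [folklore] -/
theorem fibreTwo_add_one_add_wdelta_eq_card_block_of_hTwo_eq_zero (hc2 : c * c = 1) (hc1 : c ≠ 1)
    (hcen : ∀ x : G, x * c = c * x) (T₀ : CMF G c) (h : hTwo c = 0) :
    fibreTwo c hc2 + 1 + wdelta c T₀ = Fintype.card (Block c) := by
  have h1 := card_block_add_halfRank_eq_fibreTwo_add c hc2 hc1 hcen T₀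
  rw [halfRank_eq_zero_of_hTwo_eq_zero c hc2 hc1 h] at h1
  omega

/-- **Complemented `c` ⇒ `t = 0`** (parts XII–XIII: the direct-factor theorem, re-read through the law). [folklore] -/
theorem halfRank_eq_zero_of_cpl (hc2 : c * c = 1) (hc1 : c ≠ 1) (hcen : ∀ x : G, x * c = c * x) {A : Subgroup G}
    (hA : ∀ x : G, x ∈ A ↔ c * x ∉ A) : halfRank c hc2 = 0 := by
  obtain ⟨T, hT⟩ := exists_isCMF c hc2 hc1
  have h := card_block_add_halfRank_eq_fibreTwo_add c hc2 hc1 hcen ⟨T, hT⟩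
  have h2 := Coinvariant.fibreTwo_add_one_add_wdelta_eq_card_block_of_cpl c hc2 hc1 hcen hA ⟨T, hT⟩
  omega

end

end Summit.HodgeConjecture.CorCM.Census.HalfParity
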